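import Summits.QuantumFields.YangMills.Theorems.BalabanUVNodesPortS1ChartLawStar

/-!
# NODE O port PT-A — FE-1's chart law (T1), brick (B2)-discharge of `Lines/pta_residueW-LOCATING-S1-Bstar-v2.md` §3: THE k- AND VOLUME-UNIFORM ROW BOUND ON THE ELIMINATION OPERATOR `C = [−A₁⁻¹A₂ ; 1]`
# (`recordCopFluct`) — `‖C·y‖_∞ ≤ κ(d,L,α)·‖y‖_∞`, `κ = 3 ∕ ((L^{1−d} − 157α)·R)`, `R = 1∕(10⁸dL)` — hence the `D̃`-ball condition `hCr` of the solved-form chart law ★ holds for every window radius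
# `r` with `κ·r ≤ ρD`, and ★ with (B2) DISCHARGED ([I] p.267–268: «B′ = CB … h(c) an inverse of a coefficient at B′(b₀(c))», the constants depending on `d, L` only)

Cell `ym-nodeO-ideate`, porter seat PT-A-1 (gen 14); `--kind proof --supports stmt-QuantumFields-27930 --as helper`; count-neutral.  [I] = [Balaban1987RG1]; [B7] = [Balaban1985Averaging].
Docket ★★★ director-ym №691 (2)(a).  Over ✓`…PortS1QtCHopBound` (`norm_recordLQt_bondVec_b0_ge`, `abs_le_norm_sum_smul_su2Gen`, `norm_le_three_mul_of_mem_lieSU`), ✓`…QtCQuad`∕`…QtCReal`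
(`norm_recordQtC_le_one`, `differentiableOn_recordQtC_ball`, `recordLQtC_ofReal`), lit ✓`B13ExpansionOrder` (`norm_homPart_le`, `homPart_one`, `beginsAt_one` — the Cauchy bound along complex
lines), DEF-1 ✓`recordXLoc`∕`recordCopFluct`∕`recordLQtB0_mul_recordXLoc`, ✓`…PortS1ChartLawStar` (★).

WHAT IS PROVED (0 `def`, 0 `sorry`; `θ := L^{1−d} − 157α`).
§1 ★ `norm_recordLQt_le` — `‖LQ̃(Vk) v‖ ≤ R⁻¹·‖v‖` for EVERY real coordinate vector `v` (Cauchy bound of the holomorphic `Q̃_ℂ`, `‖Q̃_ℂ‖ ≤ 1` on the `R`-ball, along the complex line through `v`;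
  NO dimension factor — the sup-norm ball contains every complex line segment of sup-norm `< R`).
§2 `abs_su2Coord_le_norm`, `recordLQtOff_mulVec_eq`, ★★ `abs_recordXLoc_mulVec_le` — `θ·|(A₁⁻¹A₂·y)(c,j)| ≤ 3·R⁻¹·‖y‖` (the real `3 × 3` block `A₁(c)` is bounded below by `θ∕3`, ✓`norm_recordLQt_bondVec_b0_ge`;
  `A₂·y` is a coordinate of `LQ̃` applied to the zero-extension of `y`, §1).
§3 ★★★ `norm_recordCopFluct_mulVec_le` — `‖↑(1 • (C·y))‖ ≤ (3 ∕ (θ·R))·‖y‖`; ★★ `hCr_of_rowBound` — the `hCr` clause of ★ for every `r` with `(3∕(θ_D·R))·r ≤ ρD`.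
§4 ★★★ `transportOfRecord_ae_eq_integral_solvedChart_of_radius` and ★★★ `TcanOfRecord_eq_integral_solvedChart_of_radius` — ★ (a.e. and pointwise) with (B2) replaced by the NUMERIC condition
  `(3∕(θ_D·R))·r ≤ ρD` (`θ_D = L^{1−d} − 157αD`): the only consumer-side hypotheses left are the budget (B1), the support clause (S) and, pointwise, the continuity `hgc`.

HONEST FRAMING.  Crude explicit constants (`κ ≈ 3·10⁸dL∕θ`); an operator bound on DEF-1's linearised objects, no estimate of Bałaban's RG flow; (B-T2) NOT here; `FEChartLawReg`∕`FEPolymerActivitiesReg`∕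
`P0HolExtAtRecordGL`∕`ClassP2Reg`∕`RegSelSmoothOnClass`∕`RegClassNestsUc` inhabited NOWHERE; ⟨27930⟩ OPEN 2∕7 · no claim; NODE O 0∕1; COUNT 8∕28 · K 1∕4 · legs 0∕6 UNMOVED; finite `𝕋⁴_{L^K}` at
fixed ε — NOT continuum ∕ OS; **the Yang–Mills mass gap (Clay) is NOT proved by any of this.**  No `sorry`, no `def`, no `instance`; standard axioms only.
-/

noncomputable section

open MeasureTheory MeasureTheory.Measure Set Metric Function Filter Topology
open scoped ENNReal NNReal BigOperators Matrix.Norms.L2Operator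

namespace Summit.QuantumFields.YangMills.Theorems.BalabanUVNodesPortS1

open Literature.MathematicalPhysics.QuantumFieldTheory (haarProbability)
open Literature.MathematicalPhysics.QuantumFieldTheory.Balaban1983to89
open Literature.MathematicalPhysics.QuantumFieldTheory.Balaban1983to89.Node00
open Literature.MathematicalPhysics.QuantumFieldTheory.Balaban1983to89.T4Continuum (T4Family)
open Literature.MathematicalPhysics.QuantumFieldTheory.Balaban1983to89.T4AdjointCovarianceUnitary (lieSU)
open Literature.MathematicalPhysics.QuantumFieldTheory.Balaban1983to89.B10Eq22Rescaling (sigmaSU2 sigmaSU2_zero)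
open Literature.MathematicalPhysics.QuantumFieldTheory.Balaban1983to89.BlockAveraging (avgFun loopHol Small Idx)
open Literature.MathematicalPhysics.QuantumFieldTheory.Balaban1983to89.BlockAveragingHaarAC (centralBond pre post centralBond_injective)
open Literature.MathematicalPhysics.QuantumFieldTheory.Balaban1983to89.BlockAveragingEMLHaarAC (fibreFamily offCard)
open Literature.MathematicalPhysics.QuantumFieldTheory.Balaban1983to89.ExpMeanLog (expMeanLogSU deltaSU)
open Literature.MathematicalPhysics.QuantumFieldTheory.Balaban1983to89.B13ExpansionOrder (homPart homPart_one norm_homPart_le beginsAt_one)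
open Summit.QuantumFields.YangMills.Theorems.K0RecordFormatNames
open Summit.QuantumFields.YangMills.Theorems.BalabanUVNodesN11TransportOfRecordInPrivateCoordinateChart (succ_le_m_add_K)
open _root_.Matrix

variable (F : T4Family)

/-! ## §1  The operator bound on `LQ̃` (Cauchy along complex lines) -/

section LQt

variable {F}

/-- ★ **`‖LQ̃(Vk) v‖ ≤ R⁻¹·‖v‖`** for every real coordinate vector `v` (`R = 1∕(10⁸dL)`): `LQ̃_ℂ = DQ̃_ℂ(0)` is the degree-one homogeneous part of the holomorphic `Q̃_ℂ`, bounded by `1` on the sup-norm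
`R`-ball (✓`norm_recordQtC_le_one`), so the Cauchy bound along the complex line through `w` gives `‖LQ̃_ℂ w‖ ≤ ‖w‖∕R` (lit ✓`norm_homPart_le`, no dimension factor); `LQ̃_ℂ ↑v = LQ̃ v`
(✓`recordLQtC_ofReal`). [cite: Balaban1987RG1, p.267 («L is a linear transformation»); Balaban1985Averaging, Prop. 3 p.36] -/
theorem norm_recordLQt_le {k K : ℕ} (hk : k + 1 ≤ (F.P K).m + (F.P K).K) (Vk : GaugeField (F.P K) k (SU 2)) {ε : ℝ}
    (hε : ∀ (c : PBond (F.P K) (k + 1)) (i : Idx (F.P K)), ‖loopM (coeField Vk) c i - 1‖ ≤ ε) (hε50 : ε ≤ 1 / 50) (hVk : ∀ c, Small expMeanLogSU Vk c)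
    (v : FluctIdx F k K → ℝ) : ‖recordLQt F k K Vk v‖ ≤ ((1 : ℝ) / (10 ^ 8 * (F.P K).d * (F.P K).L))⁻¹ * ‖v‖ := by
  have hd : (1 : ℝ) ≤ (F.P K).d := by exact_mod_cast (F.P K).hd
  have hL : (1 : ℝ) ≤ (F.P K).L := by exact_mod_cast (F.P K).hL.2.le
  have hR : (0 : ℝ) < (1 : ℝ) / (10 ^ 8 * (F.P K).d * (F.P K).L) := by positivity
  have hdiff := differentiableOn_recordQtC_ball F k K hk Vk hε hε50 hVk
  have hM := norm_recordQtC_le_one F k K hk Vk hε hε50 hVk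
  have h0 := recordQtC_zero_fun F k K Vk hVk
  have hB := beginsAt_one hR hdiff h0
  -- the operator norm of `LQ̃_ℂ` is at most `R⁻¹`
  have hop : ‖recordLQtC F k K Vk‖ ≤ ((1 : ℝ) / (10 ^ 8 * (F.P K).d * (F.P K).L))⁻¹ := by
    refine ContinuousLinearMap.opNorm_le_of_ball hR (by positivity) fun w hw => ?_
    have h := norm_homPart_le (n := 1) hdiff hM hB hw
    rw [homPart_one ((hdiff.differentiableAt (isOpen_ball.mem_nhds (mem_ball_self hR)))), pow_one] at h
    calc ‖recordLQtC F k K Vk w‖ = ‖fderiv ℂ (recordQtC F k K Vk) 0 w‖ := rfl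
      _ ≤ 1 * (‖w‖ / ((1 : ℝ) / (10 ^ 8 * (F.P K).d * (F.P K).L))) := h
      _ = ((1 : ℝ) / (10 ^ 8 * (F.P K).d * (F.P K).L))⁻¹ * ‖w‖ := by rw [one_mul, div_eq_inv_mul]
  rw [← recordLQtC_ofReal F k K hk Vk hε hε50 hVk v, ← norm_ofReal_pi_eq v]
  exact (recordLQtC F k K Vk).le_of_opNorm_le hop _

end LQt

/-! ## §2  The `b₀`-block inverse applied to `A₂·y` -/

section XLoc

variable {F}

/-- `|su2Coord M j| ≤ ‖M‖` for `M ∈ 𝔰𝔲(2)`. [folklore] -/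
theorem abs_su2Coord_le_norm {M : MatA 2} (hM : M ∈ lieSU (Fin 2)) (j : Fin 3) : |su2Coord M j| ≤ ‖M‖ := by
  have h := abs_le_norm_sum_smul_su2Gen (su2Coord M) j
  rwa [sum_su2Coord_smul_su2Gen hM] at h

/-- `A₂·y` is a coordinate of `LQ̃` applied to the zero-extension of the remaining variables `y`: `(recordLQtOff Vk *ᵥ y)(c, j) = su2Coord (LQ̃(Vk)(ext₀ y) c) j`. [cite: Balaban1987RG1, p.267–268 (bookkeeping)] -/
theorem recordLQtOff_mulVec_eq {k K : ℕ} (Vk : GaugeField (F.P K) k (SU 2)) (y : NonB0Idx F k K → ℝ) (cj : CoarseIdx F k K) :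
    (recordLQtOff F k K Vk *ᵥ y) cj =
      su2Coord (recordLQt F k K Vk (fun i : FluctIdx F k K => if h : i.1 ∈ Set.range (recordB0 F k K) then 0 else y ⟨i, h⟩) cj.1) cj.2 := by
  classical
  rw [← recordLQtMat_mulVec]
  simp only [Matrix.mulVec, dotProduct, recordLQtOff]
  rw [← Fintype.sum_subtype_add_sum_subtype (fun i : FluctIdx F k K => i.1 ∈ Set.range (recordB0 F k K))
    (fun i => recordLQtMat F k K Vk cj i * (if h : i.1 ∈ Set.range (recordB0 F k K) then 0 else y ⟨i, h⟩))]
  have h1 : ∑ i : {i : FluctIdx F k K // i.1 ∈ Set.range (recordB0 F k K)},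
      recordLQtMat F k K Vk cj i.1 * (if h : (i.1).1 ∈ Set.range (recordB0 F k K) then 0 else y ⟨i.1, h⟩) = 0 :=
    Finset.sum_eq_zero fun i _ => by rw [dif_pos i.2, mul_zero]
  rw [h1, zero_add]
  exact Finset.sum_congr rfl fun i _ => by rw [dif_neg i.2]

/-- ★★ **`θ·|(A₁⁻¹A₂·y)(c, j)| ≤ 3·R⁻¹·‖y‖`**, `θ = L^{1−d} − 157α`: the row `(c, ·)` of `X·y = A₁⁻¹A₂·y` solves the REAL `3 × 3` block equation `A₁(c)·u = (A₂·y)(c, ·)` (`A₁` is block-diagonal,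
✓`recordLQtB0_apply_of_ne`), `A₁(c)` is bounded below by `θ∕3` (✓`norm_recordLQt_bondVec_b0_ge`), and `|(A₂·y)(c, j)| ≤ R⁻¹‖y‖` (§1). [cite: Balaban1987RG1, p.267 («h(c) … an inverse of a coefficient»); Balaban1985Averaging, Prop. 3 (124) p.36] -/
theorem abs_recordXLoc_mulVec_le {k K : ℕ} (hk : k + 1 ≤ (F.P K).m + (F.P K).K) (Vk : GaugeField (F.P K) k (SU 2)) {α : ℝ}
    (hα : ∀ (c : PBond (F.P K) (k + 1)) (i : Idx (F.P K)), dist1 (loopHol Vk c i) ≤ α) (hα24 : α ≤ 1 / 24) (hαL : 157 * α < (((F.P K).L : ℝ) ^ ((F.P K).d - 1))⁻¹)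
    (y : NonB0Idx F k K → ℝ) (cj : CoarseIdx F k K) :
    ((((F.P K).L : ℝ) ^ ((F.P K).d - 1))⁻¹ - 157 * α) * |(recordXLoc F k K Vk *ᵥ y) cj| ≤ 3 * (((1 : ℝ) / (10 ^ 8 * (F.P K).d * (F.P K).L))⁻¹ * ‖y‖) := by
  classical
  have hα50 : α ≤ 1 / 50 := alpha_le_fiftieth_of_lt F K hαL
  have hε := norm_loopM_sub_one_le_of_dist1 F Vk hα
  have hsmall := small_of_dist1_le F Vk hα hα50
  have hA : RecordB0BlockInvertible F k K Vk := recordB0BlockInvertible_of_loopSmall F k K hk Vk hα hα24 hαL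
  set θ : ℝ := (((F.P K).L : ℝ) ^ ((F.P K).d - 1))⁻¹ - 157 * α with hθdef
  have hθ : 0 < θ := sub_pos.2 hαL
  set A := recordLQtB0 F k K Vk with hAdef
  set X := recordXLoc F k K Vk with hXdef
  set T : ℝ := ((1 : ℝ) / (10 ^ 8 * (F.P K).d * (F.P K).L))⁻¹ * ‖y‖ with hTdef
  obtain ⟨c, j⟩ := cj
  set u : Fin 3 → ℝ := fun j' => (X *ᵥ y) (c, j') with hudef
  -- the zero-extension of `y` has the same sup norm
  set y₀ : FluctIdx F k K → ℝ := fun i => if h : i.1 ∈ Set.range (recordB0 F k K) then 0 else y ⟨i, h⟩ with hy₀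
  have hy₀n : ‖y₀‖ ≤ ‖y‖ := by
    refine (pi_norm_le_iff_of_nonneg (norm_nonneg _)).2 fun i => ?_
    by_cases h : i.1 ∈ Set.range (recordB0 F k K)
    · simp only [hy₀, dif_pos h, norm_zero]; exact norm_nonneg _
    · simp only [hy₀, dif_neg h]; exact norm_le_pi_norm y ⟨i, h⟩
  -- `|(A₂·y)(c, jj)| ≤ T`
  have hT : ∀ jj, |(recordLQtOff F k K Vk *ᵥ y) (c, jj)| ≤ T := by
    intro jj
    rw [recordLQtOff_mulVec_eq]
    refine (abs_su2Coord_le_norm (recordLQt_mem_lieSU_of_small F k K Vk hsmall _ c) jj).trans ((norm_le_pi_norm _ c).trans ?_)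
    refine (norm_recordLQt_le hk Vk hε hα50 hsmall y₀).trans ?_
    exact mul_le_mul_of_nonneg_left hy₀n (by positivity)
  -- the block equation `Σ_{j'} A(c,jj)(c,j') u j' = (A₂·y)(c,jj)`
  have hblock : ∀ jj, ∑ j', A (c, jj) (c, j') * u j' = (recordLQtOff F k K Vk *ᵥ y) (c, jj) := by
    intro jj
    have h := congrFun (congrArg (fun M => M *ᵥ y) (recordLQtB0_mul_recordXLoc F k K Vk hA)) (c, jj)
    rw [← Matrix.mulVec_mulVec] at h
    rw [← h]
    simp only [Matrix.mulVec, dotProduct]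
    rw [Fintype.sum_prod_type, Finset.sum_eq_single c]
    · rfl
    · intro c' _ hc'
      exact Finset.sum_eq_zero fun j' _ => by rw [recordLQtB0_apply_of_ne F k K hk Vk (Ne.symm hc'), zero_mul]
    · intro h; exact absurd (Finset.mem_univ c) h
  -- the real block is bounded below
  have h1 := abs_le_norm_sum_smul_su2Gen u j
  have h2 := norm_recordLQt_bondVec_b0_ge F k K hk Vk hα hα24 c u
  have h3 : ‖recordLQt F k K Vk (fun i : FluctIdx F k K => if i.1 = recordB0 F k K c then u i.2 else 0) c‖ ≤ 3 * T := by
    refine norm_le_three_mul_of_mem_lieSU (recordLQt_mem_lieSU_of_small F k K Vk hsmall _ c) fun j' => ?_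
    rw [← b0Block_mulVec F k K Vk c u j']
    have : (Matrix.of fun j j' : Fin 3 => recordLQtB0 F k K Vk (c, j) (c, j')).mulVec u j' = ∑ j'', A (c, j') (c, j'') * u j'' := by
      simp only [Matrix.mulVec, dotProduct, Matrix.of_apply, hAdef]
    rw [this, hblock j']
    exact hT j'
  have h4 : θ * |u j| ≤ θ * ‖∑ a, ((u a : ℝ) : ℂ) • su2Gen a‖ := mul_le_mul_of_nonneg_left h1 hθ.le
  linarith

end XLoc

/-! ## §3  The row bound on `C = [−X ; 1]` and the `D̃`-ball condition `hCr` -/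

section Cop

variable {F}

/-- ★★★ **THE k- AND VOLUME-UNIFORM ROW BOUND ON THE ELIMINATION OPERATOR**: `‖↑(1 • (recordCopFluct Vk *ᵥ y))‖ ≤ (3 ∕ (θ·R))·‖y‖`, `θ = L^{1−d} − 157α`, `R = 1∕(10⁸dL)`, for `Vk` with loops `≤ α ≤ 1∕24`,
`157α < L^{1−d}` (non-`b₀` rows of `C·y` ARE `y`, ✓`recordCopFluct_mulVec_apply_of_not_mem`; `b₀`-rows are `−X·y`, ✓`recordCopFluct_mulVec_apply_b0`, §2; and `1 ≤ 3∕(θR)`).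
[cite: Balaban1987RG1, p.267–268 («B′ = CB»)] -/
theorem norm_recordCopFluct_mulVec_le {k K : ℕ} (hk : k + 1 ≤ (F.P K).m + (F.P K).K) (Vk : GaugeField (F.P K) k (SU 2)) {α : ℝ} (hα0 : 0 ≤ α)
    (hα : ∀ (c : PBond (F.P K) (k + 1)) (i : Idx (F.P K)), dist1 (loopHol Vk c i) ≤ α) (hα24 : α ≤ 1 / 24) (hαL : 157 * α < (((F.P K).L : ℝ) ^ ((F.P K).d - 1))⁻¹)
    (y : NonB0Idx F k K → ℝ) :
    ‖(fun i => ((((1 : ℝ) • (recordCopFluct F k K Vk *ᵥ y)) i : ℝ) : ℂ))‖ ≤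
      3 / (((((F.P K).L : ℝ) ^ ((F.P K).d - 1))⁻¹ - 157 * α) * ((1 : ℝ) / (10 ^ 8 * (F.P K).d * (F.P K).L))) * ‖y‖ := by
  classical
  have hd : (1 : ℝ) ≤ (F.P K).d := by exact_mod_cast (F.P K).hd
  have hL : (1 : ℝ) ≤ (F.P K).L := by exact_mod_cast (F.P K).hL.2.le
  set θ : ℝ := (((F.P K).L : ℝ) ^ ((F.P K).d - 1))⁻¹ - 157 * α with hθdef
  have hθ : 0 < θ := sub_pos.2 hαL
  set R : ℝ := (1 : ℝ) / (10 ^ 8 * (F.P K).d * (F.P K).L) with hRdef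
  have hR : 0 < R := by positivity
  have hRle : R ≤ 1 := by
    rw [hRdef, div_le_one (by positivity)]; nlinarith
  have hθle : θ ≤ 1 := by
    have hLpow : (1 : ℝ) ≤ ((F.P K).L : ℝ) ^ ((F.P K).d - 1) := one_le_pow₀ hL
    have : (((F.P K).L : ℝ) ^ ((F.P K).d - 1))⁻¹ ≤ 1 := inv_le_one_of_one_le₀ hLpow
    linarith
  have hκ1 : 1 ≤ 3 / (θ * R) := by
    rw [le_div_iff₀ (mul_pos hθ hR), one_mul]
    nlinarith [mul_le_mul hθle hRle hR.le zero_le_one]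
  rw [norm_ofReal_pi_eq, one_smul]
  refine (pi_norm_le_iff_of_nonneg (by positivity)).2 fun i => ?_
  rw [Real.norm_eq_abs]
  by_cases h : i.1 ∈ Set.range (recordB0 F k K)
  · -- a `b₀`-row: `(C·y) i = −(X·y)(c, i.2)`
    obtain ⟨c, hc⟩ := h
    have hi : i = (recordB0 F k K c, i.2) := Prod.ext hc.symm rfl
    rw [hi, recordCopFluct_mulVec_apply_b0 F k K hk Vk y (c, i.2), abs_neg]
    have hX := abs_recordXLoc_mulVec_le hk Vk hα hα24 hαL y (c, i.2)
    rw [div_mul_eq_mul_div, le_div_iff₀ (mul_pos hθ hR)]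
    calc |(recordXLoc F k K Vk *ᵥ y) (c, i.2)| * (θ * R) = (θ * |(recordXLoc F k K Vk *ᵥ y) (c, i.2)|) * R := by ring
      _ ≤ 3 * (R⁻¹ * ‖y‖) * R := mul_le_mul_of_nonneg_right hX hR.le
      _ = 3 * ‖y‖ := by field_simp
  · -- a remaining row: `(C·y) i = y i`
    rw [recordCopFluct_mulVec_apply_of_not_mem F k K Vk y ⟨i, h⟩]
    calc |y ⟨i, h⟩| = ‖y ⟨i, h⟩‖ := (Real.norm_eq_abs _).symm
      _ ≤ ‖y‖ := norm_le_pi_norm y ⟨i, h⟩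
      _ = 1 * ‖y‖ := (one_mul _).symm
      _ ≤ 3 / (θ * R) * ‖y‖ := mul_le_mul_of_nonneg_right hκ1 (norm_nonneg _)

/-- On DEF-1's reduced window the sup norm of the remaining variables is `< r`: `|y(b,a)| ≤ √(Σ_a y(b,a)²) < r`. [cite: Balaban1987RG1, (2.9) p.266 (bookkeeping)] -/
theorem norm_lt_of_mem_remWindow {k K : ℕ} {r : ℝ} (hr : 0 < r) (y : NonB0Idx F k K → ℝ)
    (hy : ∀ (b : PBond (F.P K) k) (hb : b ∉ Set.range (recordB0 F k K)), √(∑ a : Fin 3, y ⟨(b, a), hb⟩ ^ 2) < r) : ‖y‖ < r := by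
  refine (pi_norm_lt_iff hr).2 fun i => ?_
  have h := hy i.1.1 i.2
  calc ‖y i‖ = ‖fluctVecRem F k K y ⟨i.1.1, i.2⟩ i.1.2‖ := by rw [fluctVecRem_apply]
    _ ≤ ‖fluctVecRem F k K y ⟨i.1.1, i.2⟩‖ := PiLp.norm_apply_le _ _
    _ < r := by rw [norm_fluctVecRem_apply]; exact h

/-- ★★ **THE `D̃`-BALL CONDITION `hCr` OF ★ FROM THE ROW BOUND**: for `ctr W` on its own fibre with loops `≤ αD ≤ 1∕24`, `157αD < L^{1−d}`, and every radius `r > 0` with `(3∕(θ_D·R))·r ≤ ρD`: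
`‖↑(1 • (C_{ctr W}·y))‖ < ρD` on `remWindow r`. [cite: Balaban1987RG1, p.267–268, (2.9) p.266] -/
theorem hCr_of_rowBound {K k : ℕ} (hk : k < K) {αD r ρD : ℝ} (hαD0 : 0 ≤ αD) (hαD24 : αD ≤ 1 / 24) (hαDL : 157 * αD < (((F.P K).L : ℝ) ^ ((F.P K).d - 1))⁻¹) (hr : 0 < r)
    (hrρ : 3 / (((((F.P K).L : ℝ) ^ ((F.P K).d - 1))⁻¹ - 157 * αD) * ((1 : ℝ) / (10 ^ 8 * (F.P K).d * (F.P K).L))) * r ≤ ρD)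
    (ctr : (PBond (F.P K) (k + 1) → SU 2) → GaugeField (F.P K) k (SU 2)) :
    ∀ W : PBond (F.P K) (k + 1) → SU 2, (avOfRecord F 2 K k).avg (ctr W) = W → (∀ (c : PBond (F.P K) (k + 1)) (i : Idx (F.P K)), dist1 (loopHol (ctr W) c i) ≤ αD) →
      ∀ y : NonB0Idx F k K → ℝ, (∀ (b : PBond (F.P K) k) (hb : b ∉ Set.range (recordB0 F k K)), √(∑ a : Fin 3, y ⟨(b, a), hb⟩ ^ 2) < r) →
        ‖(fun i => ((((1 : ℝ) • (recordCopFluct F k K (ctr W) *ᵥ y)) i : ℝ) : ℂ))‖ < ρD := by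
  intro W _ hWD y hy
  have hkr : k + 1 ≤ (F.P K).m + (F.P K).K := succ_le_m_add_K hk
  have hd : (1 : ℝ) ≤ (F.P K).d := by exact_mod_cast (F.P K).hd
  have hL : (1 : ℝ) ≤ (F.P K).L := by exact_mod_cast (F.P K).hL.2.le
  have hθ : 0 < (((F.P K).L : ℝ) ^ ((F.P K).d - 1))⁻¹ - 157 * αD := sub_pos.2 hαDL
  have hκ : 0 < 3 / (((((F.P K).L : ℝ) ^ ((F.P K).d - 1))⁻¹ - 157 * αD) * ((1 : ℝ) / (10 ^ 8 * (F.P K).d * (F.P K).L))) := by positivity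
  have hyn := norm_lt_of_mem_remWindow hr y hy
  refine lt_of_le_of_lt (norm_recordCopFluct_mulVec_le hkr (ctr W) hαD0 hWD hαD24 hαDL y) (lt_of_lt_of_le ?_ hrρ)
  exact mul_lt_mul_of_pos_left hyn hκ

end Cop


/-! ## §4  ★ with the `D̃`-ball condition (B2) discharged by the row bound -/

section Star

variable {F}

/-- ★★★ **(★-ae) WITH (B2) DISCHARGED**: as ✓`transportOfRecord_ae_eq_integral_solvedChart`, with the `D̃`-ball hypothesis `hCr` REPLACED by the numeric condition
`(3 ∕ (θ_D·R))·r ≤ ρD` on the window radius (`θ_D = L^{1−d} − 157αD`, `R = 1∕(10⁸dL)`; ✓`hCr_of_rowBound`). The consumer-side hypotheses left: the budget (B1) and the support clause (S).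
[cite: Balaban1987RG1, (2.10) p.267, p.268 L1–3, (2.9) p.266] [cite: Balaban1985UV3, (18) p.260] -/
theorem transportOfRecord_ae_eq_integral_solvedChart_of_radius {K k : ℕ} (hk : k < K) {α αD r : ℝ} (hα0 : 0 ≤ α) (hα : α ≤ 1 / 24) (hα64 : 64 * α ≤ deltaSU (Fin 2))
    (hαL : 157 * α < (((F.P K).L : ℝ) ^ ((F.P K).d - 1))⁻¹)
    (hgap : ∀ c : PBond (F.P K) (k + 1), (offCard c : ℝ) / (Fintype.card (Idx (F.P K)) : ℝ) + 150 * α < 1)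
    (hαD0 : 0 ≤ αD) (hbudget : αD + ((((F.P K).d + 2) * (F.P K).L : ℕ) : ℝ) * (Real.exp (3 * ((1 : ℝ) / (10 ^ 8 * (F.P K).d * (F.P K).L))) - 1) ≤ α)
    (hr0 : 0 < r) (hrR : r ≤ (1 : ℝ) / (10 ^ 8 * (F.P K).d * (F.P K).L)) {ρD : ℝ}
    (hρD : ρD = (min ((1 : ℝ) / (10 ^ 8 * (F.P K).d * (F.P K).L) / 3) (1 / (18 * (2 * 1 / (1 / (10 ^ 8 * (F.P K).d * (F.P K).L)) ^ 2) * ((6 / ((((F.P K).L : ℝ) ^ ((F.P K).d - 1))⁻¹ - 157 * αD)) + 1)))))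
    (hrρ : 3 / (((((F.P K).L : ℝ) ^ ((F.P K).d - 1))⁻¹ - 157 * αD) * ((1 : ℝ) / (10 ^ 8 * (F.P K).d * (F.P K).L))) * r ≤ ρD)
    (ctr : (PBond (F.P K) (k + 1) → SU 2) → GaugeField (F.P K) k (SU 2))
    {ρ : Density (F.P K) k (SU 2)} (hρm : Measurable ρ) (hρ : Integrable ρ (fieldMeasure (F.P K) k (SU 2)))
    (hS : ∀ U, ρ U ≠ 0 → (∀ (c : PBond (F.P K) (k + 1)) (i : Idx (F.P K)), dist1 (loopHol U c i) < α) ∧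
      ∃ x : FluctIdx F k K → ℝ, (∀ b, ‖fluctVec F k K x b‖ < r) ∧ U = pert F k K (ctr ((avOfRecord F 2 K k).avg U)) x) :
    ∀ᵐ W ∂(fieldMeasure (F.P K) (k + 1) (SU 2)),
      ((avOfRecord F 2 K k).avg (ctr W) = W ∧ ∀ (c : PBond (F.P K) (k + 1)) (i : Idx (F.P K)), dist1 (loopHol (ctr W) c i) ≤ αD) →
      transportOfRecord F 2 K k ρ W =
        (sigmaSU2 0) ^ Fintype.card {b : PBond (F.P K) k // b ∉ Set.range (recordB0 F k K)} *
          ∫ y in {y : NonB0Idx F k K → ℝ | ∀ (b : PBond (F.P K) k) (hb : b ∉ Set.range (recordB0 F k K)), √(∑ a : Fin 3, y ⟨(b, a), hb⟩ ^ 2) < r},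
            fluctSigma (fluctVec F k K (recordReparamOf F k (fun Vk => recordDt F k K Vk ρD) (ctr W) 1 (recordCopFluct F k K (ctr W) *ᵥ y))) *
          ((∏ c : PBond (F.P K) (k + 1),
              |(fderiv ℝ (fun a : EuclideanSpace ℝ (Fin 3) =>
                  (WithLp.toLp 2 (su2Coord (recordQt F k K (ctr W) ((fluctVec F k K).symm (update (fluctVec F k K
                    (recordReparamOf F k (fun Vk => recordDt F k K Vk ρD) (ctr W) 1 (recordCopFluct F k K (ctr W) *ᵥ y))) (centralBond c) a)) c)) : EuclideanSpace ℝ (Fin 3)))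
                (fluctVec F k K (recordReparamOf F k (fun Vk => recordDt F k K Vk ρD) (ctr W) 1 (recordCopFluct F k K (ctr W) *ᵥ y)) (centralBond c))).det|)⁻¹ *
            ρ (pert F k K (ctr W) (recordReparamOf F k (fun Vk => recordDt F k K Vk ρD) (ctr W) 1 (recordCopFluct F k K (ctr W) *ᵥ y)))) := by
  have hbud0 : (0 : ℝ) ≤ ((((F.P K).d + 2) * (F.P K).L : ℕ) : ℝ) * (Real.exp (3 * ((1 : ℝ) / (10 ^ 8 * (F.P K).d * (F.P K).L))) - 1) :=
    mul_nonneg (Nat.cast_nonneg _) (by linarith [Real.add_one_le_exp (3 * ((1 : ℝ) / (10 ^ 8 * ((F.P K).d : ℝ) * (F.P K).L)))])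
  have hαDα : αD ≤ α := by linarith
  have hαD24 : αD ≤ 1 / 24 := hαDα.trans hα
  have hαDL : 157 * αD < (((F.P K).L : ℝ) ^ ((F.P K).d - 1))⁻¹ := by linarith
  exact transportOfRecord_ae_eq_integral_solvedChart hk hα0 hα hα64 hαL hgap hbudget hrR hρD ctr
    (hCr_of_rowBound hk hαD0 hαD24 hαDL hr0 hrρ ctr) hρm hρ hS

/-- ★★★ **(★) WITH (B2) DISCHARGED**: the pointwise form on every open `U₀ ⊆ G` carrying the consumer's continuity `hgc`, with `hCr` replaced by `(3 ∕ (θ_D·R))·r ≤ ρD`.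
[cite: Balaban1987RG1, (2.10) p.267, (0.19) p.255, p.259] [cite: Balaban1985UV3, (18) p.260] -/
theorem TcanOfRecord_eq_integral_solvedChart_of_radius {K k : ℕ} (hk : k < K) {α αD r : ℝ} (hα0 : 0 ≤ α) (hα : α ≤ 1 / 24) (hα64 : 64 * α ≤ deltaSU (Fin 2))
    (hαL : 157 * α < (((F.P K).L : ℝ) ^ ((F.P K).d - 1))⁻¹)
    (hgap : ∀ c : PBond (F.P K) (k + 1), (offCard c : ℝ) / (Fintype.card (Idx (F.P K)) : ℝ) + 150 * α < 1)
    (hαD0 : 0 ≤ αD) (hbudget : αD + ((((F.P K).d + 2) * (F.P K).L : ℕ) : ℝ) * (Real.exp (3 * ((1 : ℝ) / (10 ^ 8 * (F.P K).d * (F.P K).L))) - 1) ≤ α)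
    (hr0 : 0 < r) (hrR : r ≤ (1 : ℝ) / (10 ^ 8 * (F.P K).d * (F.P K).L)) {ρD : ℝ}
    (hρD : ρD = (min ((1 : ℝ) / (10 ^ 8 * (F.P K).d * (F.P K).L) / 3) (1 / (18 * (2 * 1 / (1 / (10 ^ 8 * (F.P K).d * (F.P K).L)) ^ 2) * ((6 / ((((F.P K).L : ℝ) ^ ((F.P K).d - 1))⁻¹ - 157 * αD)) + 1)))))
    (hrρ : 3 / (((((F.P K).L : ℝ) ^ ((F.P K).d - 1))⁻¹ - 157 * αD) * ((1 : ℝ) / (10 ^ 8 * (F.P K).d * (F.P K).L))) * r ≤ ρD)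
    (ctr : (PBond (F.P K) (k + 1) → SU 2) → GaugeField (F.P K) k (SU 2))
    {ρ : Density (F.P K) k (SU 2)} (hρm : Measurable ρ) (hρ : Integrable ρ (fieldMeasure (F.P K) k (SU 2)))
    (hS : ∀ U, ρ U ≠ 0 → (∀ (c : PBond (F.P K) (k + 1)) (i : Idx (F.P K)), dist1 (loopHol U c i) < α) ∧
      ∃ x : FluctIdx F k K → ℝ, (∀ b, ‖fluctVec F k K x b‖ < r) ∧ U = pert F k K (ctr ((avOfRecord F 2 K k).avg U)) x)
    {U₀ : Set (PBond (F.P K) (k + 1) → SU 2)} (hU : IsOpen U₀)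
    (hUG : ∀ W ∈ U₀, (avOfRecord F 2 K k).avg (ctr W) = W ∧ ∀ (c : PBond (F.P K) (k + 1)) (i : Idx (F.P K)), dist1 (loopHol (ctr W) c i) ≤ αD)
    (hgc : ContinuousOn (fun W : PBond (F.P K) (k + 1) → SU 2 =>
      (sigmaSU2 0) ^ Fintype.card {b : PBond (F.P K) k // b ∉ Set.range (recordB0 F k K)} *
        ∫ y in {y : NonB0Idx F k K → ℝ | ∀ (b : PBond (F.P K) k) (hb : b ∉ Set.range (recordB0 F k K)), √(∑ a : Fin 3, y ⟨(b, a), hb⟩ ^ 2) < r},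
          fluctSigma (fluctVec F k K (recordReparamOf F k (fun Vk => recordDt F k K Vk ρD) (ctr W) 1 (recordCopFluct F k K (ctr W) *ᵥ y))) *
          ((∏ c : PBond (F.P K) (k + 1),
              |(fderiv ℝ (fun a : EuclideanSpace ℝ (Fin 3) =>
                  (WithLp.toLp 2 (su2Coord (recordQt F k K (ctr W) ((fluctVec F k K).symm (update (fluctVec F k K
                    (recordReparamOf F k (fun Vk => recordDt F k K Vk ρD) (ctr W) 1 (recordCopFluct F k K (ctr W) *ᵥ y))) (centralBond c) a)) c)) : EuclideanSpace ℝ (Fin 3)))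
                (fluctVec F k K (recordReparamOf F k (fun Vk => recordDt F k K Vk ρD) (ctr W) 1 (recordCopFluct F k K (ctr W) *ᵥ y)) (centralBond c))).det|)⁻¹ *
            ρ (pert F k K (ctr W) (recordReparamOf F k (fun Vk => recordDt F k K Vk ρD) (ctr W) 1 (recordCopFluct F k K (ctr W) *ᵥ y))))) U₀) :
    EqOn (TcanOfRecord F 2 K k ρ) (fun W : PBond (F.P K) (k + 1) → SU 2 =>
      (sigmaSU2 0) ^ Fintype.card {b : PBond (F.P K) k // b ∉ Set.range (recordB0 F k K)} *
        ∫ y in {y : NonB0Idx F k K → ℝ | ∀ (b : PBond (F.P K) k) (hb : b ∉ Set.range (recordB0 F k K)), √(∑ a : Fin 3, y ⟨(b, a), hb⟩ ^ 2) < r},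
          fluctSigma (fluctVec F k K (recordReparamOf F k (fun Vk => recordDt F k K Vk ρD) (ctr W) 1 (recordCopFluct F k K (ctr W) *ᵥ y))) *
          ((∏ c : PBond (F.P K) (k + 1),
              |(fderiv ℝ (fun a : EuclideanSpace ℝ (Fin 3) =>
                  (WithLp.toLp 2 (su2Coord (recordQt F k K (ctr W) ((fluctVec F k K).symm (update (fluctVec F k K
                    (recordReparamOf F k (fun Vk => recordDt F k K Vk ρD) (ctr W) 1 (recordCopFluct F k K (ctr W) *ᵥ y))) (centralBond c) a)) c)) : EuclideanSpace ℝ (Fin 3)))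
                (fluctVec F k K (recordReparamOf F k (fun Vk => recordDt F k K Vk ρD) (ctr W) 1 (recordCopFluct F k K (ctr W) *ᵥ y)) (centralBond c))).det|)⁻¹ *
            ρ (pert F k K (ctr W) (recordReparamOf F k (fun Vk => recordDt F k K Vk ρD) (ctr W) 1 (recordCopFluct F k K (ctr W) *ᵥ y))))) U₀ := by
  have hbud0 : (0 : ℝ) ≤ ((((F.P K).d + 2) * (F.P K).L : ℕ) : ℝ) * (Real.exp (3 * ((1 : ℝ) / (10 ^ 8 * (F.P K).d * (F.P K).L))) - 1) :=
    mul_nonneg (Nat.cast_nonneg _) (by linarith [Real.add_one_le_exp (3 * ((1 : ℝ) / (10 ^ 8 * ((F.P K).d : ℝ) * (F.P K).L)))])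
  have hαDα : αD ≤ α := by linarith
  have hαD24 : αD ≤ 1 / 24 := hαDα.trans hα
  have hαDL : 157 * αD < (((F.P K).L : ℝ) ^ ((F.P K).d - 1))⁻¹ := by linarith
  exact TcanOfRecord_eq_integral_solvedChart_of_continuousOn hk hα0 hα hα64 hαL hgap hbudget hrR hρD ctr
    (hCr_of_rowBound hk hαD0 hαD24 hαDL hr0 hrρ ctr) hρm hρ hS hU hUG hgc

end Star

end Summit.QuantumFields.YangMills.Theorems.BalabanUVNodesPortS1

end
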